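import Literature.Barriers.Parity.SiegelZeroPrimePairsInitialSteps
import Literature.NumberTheory.Sieve.PairLinearFormSieve
import HarnessLib

/-!
# Matomäki–Merikoski, Lemma 2.1: the `c_n`-part of the error of (2.6), by the pair sieve

Sibling of `SiegelZeroPrimePairsInitialSteps.lean`, whose `MatomakiMerikoski2023_eq26` (Matomäki–Merikoski,
*Siegel zeros, twin primes, Goldbach's conjecture, and primes in short intervals*, IMRN 2023,
arXiv:2112.11412, §2 (2.6)) bounds `|∑ g(n/X)Λ(n)Λ(n+h) − ∑_adm g(n/X)λ'(n)λ'(n+h)|` by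
`4(π(z)+ω(q)) log²(2X+h) + log(2X+h) ∑_{adm n} (τ(n) c_{n+h} + c_n)`, `c_n = λ'(n) − Λ(n)`.  Lemma 2.1 of
the source controls such sums through Henriot's bound (Lemma 3.1 there).  This file PROVES the bound
for the second, `τ`-free term, which needs no multiplicative-function technology — only the
two-dimensional sieve for the pair of linear forms `(k, dk + h)` (the tree's
`PairLinearSieve.card_sifted_le`, `Sieve/PairLinearFormSieve.lean`):

* `MatomakiMerikoski.sum_adm_charLog_sub_vonMangoldt_le` — there is an absolute `C` with
  `∑_{n ≤ X adm} (λ'(n) − Λ(n)) ≤ C (h/φ(h)) X (log X/log² z) ∑_{z ≤ d ≤ X, d z-rough} λ(d) (d/φ(d))/d`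
  for all `X ≥ 2`, `h ≥ 1`, `z ≥ 2`, any `q` ("adm": every prime factor of `n` and of `n + h` is `≥ z`
  and coprime to `q`; `λ = 1 ∗ χ = oneConvChi χ`, `λ' = χ ∗ log = charLog χ`, `χ` quadratic).

Mechanism (the source's proof of Lemma 2.1, p. 9, first case, with the sieve in place of Henriot): on
an admissible `n`, `c_n = ∑_{n = dk, d > 1} λ(d)Λ(k)` (`charLog_sub_vonMangoldt`) where `d` is `z`-rough
and `≥ z`, `k = p^a` with `p ≥ z`, and `dk + h = n + h` is `z`-rough; for fixed `d` the number of such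
`k ≤ X/d` is `≪ (dh/φ(dh)) (X/d)/log² z` by the pair sieve, and `Λ(k) ≤ log X`.  In the source's
notation the right-hand side is `≪ (h/φ(h)) X (u²/log X) ∑ λ(m)(m/φ(m))/m` (`z = X^{1/u}`), to be fed
into Lemma 2.2 (`∑_{z ≤ m, rough} λ(m)/m` lacunary under a Siegel zero; `m/φ(m) ≤ e^{ω(m)/(z−1)}`).
The companion term `∑_adm τ(n) c_{n+h}` is NOT treated here (it needs a Nair–Tenenbaum-type bound).

## References

* K. Matomäki, J. Merikoski, IMRN 2023 (arXiv:2112.11412), Lemma 2.1 and its proof (p. 9).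
  [cite: MatomakiMerikoski2023, Lemma 2.1]
-/

noncomputable section

open Finset
open scoped ArithmeticFunction.vonMangoldt

namespace Literature.Barriers.Parity.MatomakiMerikoski

open Literature.Barriers.Parity.TaoTeravainen
open Literature.NumberTheory.Sieve (PairLinearSieve.card_sifted_le PairLinearSieve.det)

/-- `dh/φ(dh) ≤ (d/φ(d)) (h/φ(h))` (`φ` is super-multiplicative). [folklore] -/
theorem mul_div_totient_le {d h : ℕ} (hd : d ≠ 0) (hh : h ≠ 0) :
    ((d * h : ℕ) : ℝ) / Nat.totient (d * h) ≤ ((d : ℝ) / Nat.totient d) * ((h : ℝ) / Nat.totient h) := by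
  have hφd : (0 : ℝ) < Nat.totient d := by exact_mod_cast Nat.totient_pos.mpr (Nat.pos_of_ne_zero hd)
  have hφh : (0 : ℝ) < Nat.totient h := by exact_mod_cast Nat.totient_pos.mpr (Nat.pos_of_ne_zero hh)
  have hφdh : (0 : ℝ) < Nat.totient (d * h) := by
    exact_mod_cast Nat.totient_pos.mpr (Nat.pos_of_ne_zero (Nat.mul_ne_zero hd hh))
  have hsup : (Nat.totient d : ℝ) * Nat.totient h ≤ Nat.totient (d * h) := by
    exact_mod_cast Nat.totient_super_multiplicative d h
  rw [div_mul_div_comm, div_le_div_iff₀ hφdh (mul_pos hφd hφh)]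
  push_cast
  have : (0 : ℝ) ≤ (d : ℝ) * h := by positivity
  nlinarith

/-- **The `c_n`-part of Matomäki–Merikoski's Lemma 2.1, by the pair sieve.**  There is an absolute `C > 0`
such that for every quadratic Dirichlet character `χ` (any level), all naturals `X ≥ 2`, `h ≥ 1`, `q`, and
real `z ≥ 2`, writing "adm" for the `n` all of whose prime factors and all of whose prime factors of
`n + h` are `≥ z` and do not divide `q`,
`∑_{1 ≤ n ≤ X, adm} (λ'(n) − Λ(n)) ≤ C (h/φ(h)) X (log X/(log z)²) ∑_{z ≤ d ≤ X, d z-rough} λ(d)(d/φ(d))/d`.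
[cite: MatomakiMerikoski2023, Lemma 2.1 (proof, first case)] -/
theorem sum_adm_charLog_sub_vonMangoldt_le :
    ∃ C : ℝ, 0 < C ∧ ∀ (N : ℕ) [NeZero N] (χ : DirichletCharacter ℂ N), χ.IsQuadratic →
      ∀ (X h q : ℕ) (z : ℝ), 2 ≤ X → 1 ≤ h → 2 ≤ z →
        ∑ n ∈ (Icc 1 X).filter (fun n : ℕ =>
            (∀ p ∈ n.primeFactors, z ≤ (p : ℝ) ∧ ¬ p ∣ q) ∧
              (∀ p ∈ (n + h).primeFactors, z ≤ (p : ℝ) ∧ ¬ p ∣ q)),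
            (charLog χ n - Λ n) ≤
          C * ((h : ℝ) / Nat.totient h) * X * (Real.log X / Real.log z ^ 2) *
            ∑ d ∈ (Icc ⌈z⌉₊ X).filter (fun d : ℕ => ∀ p ∈ d.primeFactors, z ≤ (p : ℝ)),
              oneConvChi χ d * ((d : ℝ) / Nat.totient d) / d := by
  obtain ⟨C, hC, HS⟩ := PairLinearSieve.card_sifted_le
  refine ⟨C, hC, ?_⟩
  intro N _ χ hχ X h q z hX hh hz
  classical
  set A := (Icc 1 X).filter (fun n : ℕ =>
      (∀ p ∈ n.primeFactors, z ≤ (p : ℝ) ∧ ¬ p ∣ q) ∧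
        (∀ p ∈ (n + h).primeFactors, z ≤ (p : ℝ) ∧ ¬ p ∣ q)) with hA
  set D := (Icc ⌈z⌉₊ X).filter (fun d : ℕ => ∀ p ∈ d.primeFactors, z ≤ (p : ℝ)) with hD
  have hX0 : (0 : ℝ) < X := by exact_mod_cast (show 0 < X by omega)
  have hlogX : 0 < Real.log X := Real.log_pos (by exact_mod_cast (show 1 < X by omega))
  have hlogz : 0 < Real.log z := Real.log_pos (by linarith)
  have hz1 : 1 < z := by linarith
  have hh0 : h ≠ 0 := by omega
  have hφh : (0 : ℝ) < Nat.totient h := by exact_mod_cast Nat.totient_pos.mpr (by omega)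
  set w : ℝ := (h : ℝ) / Nat.totient h with hw
  have hw0 : 0 ≤ w := by positivity
  -- Step 1: expand `c_n` on admissible `n` and swap the sums
  have hmemA : ∀ n ∈ A, 1 ≤ n ∧ n ≤ X ∧ (∀ p ∈ n.primeFactors, z ≤ (p : ℝ)) ∧
      (∀ p ∈ (n + h).primeFactors, z ≤ (p : ℝ) ∧ ¬ p ∣ q) := by
    intro n hn
    rw [hA, Finset.mem_filter, Finset.mem_Icc] at hn
    exact ⟨hn.1.1, hn.1.2, fun p hp => (hn.2.1 p hp).1, hn.2.2⟩
  have hexpand : ∑ n ∈ A, (charLog χ n - Λ n) =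
      ∑ n ∈ A, ∑ d ∈ n.divisors.erase 1, oneConvChi χ d * Λ (n / d) :=
    Finset.sum_congr rfl fun n hn => charLog_sub_vonMangoldt χ (by have := (hmemA n hn).1; omega)
  have hswap : ∑ n ∈ A, ∑ d ∈ n.divisors.erase 1, oneConvChi χ d * Λ (n / d) =
      ∑ d ∈ Icc 2 X, ∑ n ∈ A.filter (fun n => d ∣ n), oneConvChi χ d * Λ (n / d) := by
    refine Finset.sum_comm' fun n d => ?_
    constructor
    · rintro ⟨hn, hd⟩
      rw [Finset.mem_erase, Nat.mem_divisors] at hd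
      obtain ⟨hd1, hdn, hn0⟩ := hd
      have hd0 : d ≠ 0 := fun h0 => hn0 (Nat.eq_zero_of_zero_dvd (h0 ▸ hdn))
      refine ⟨Finset.mem_filter.mpr ⟨hn, hdn⟩, Finset.mem_Icc.mpr ⟨by omega, ?_⟩⟩
      exact (Nat.le_of_dvd (by have := (hmemA n hn).1; omega) hdn).trans (hmemA n hn).2.1
    · rintro ⟨hn, hd⟩
      have hn' := Finset.mem_filter.mp hn
      have hd' := Finset.mem_Icc.mp hd
      refine ⟨hn'.1, Finset.mem_erase.mpr ⟨by omega, Nat.mem_divisors.mpr ⟨hn'.2, ?_⟩⟩⟩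
      have := (hmemA n hn'.1).1
      omega
  rw [hexpand, hswap]
  -- Step 2: the inner sum for a fixed `d`
  have hinner : ∀ d ∈ Icc 2 X, ∑ n ∈ A.filter (fun n => d ∣ n), oneConvChi χ d * Λ (n / d) ≤
      if d ∈ D then oneConvChi χ d * (Real.log X * (C * (((d * h : ℕ) : ℝ) / Nat.totient (d * h)) *
        ((X / d : ℕ) : ℝ) / Real.log z ^ 2)) else 0 := by
    intro d hd
    rw [Finset.mem_Icc] at hd
    have hd0 : d ≠ 0 := by omega
    have hlam0 : 0 ≤ oneConvChi χ d := oneConvChi_nonneg χ hχ d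
    rw [← Finset.mul_sum]
    by_cases hdD : d ∈ D
    · rw [if_pos hdD]
      refine mul_le_mul_of_nonneg_left ?_ hlam0
      -- the `n` with `Λ(n/d) ≠ 0` inject (`n ↦ n/d`) into the sieved set of `k ≤ X/d`
      set K : ℕ := X / d with hK
      set B := A.filter (fun n => d ∣ n) with hB
      set B' := B.filter (fun n => Λ (n / d) ≠ 0) with hB'
      have hsumB : ∑ n ∈ B, Λ (n / d) = ∑ n ∈ B', Λ (n / d) := by
        rw [hB', Finset.sum_filter_ne_zero]
      rw [hsumB]
      have hΛle : ∀ n ∈ B', Λ (n / d) ≤ Real.log X := by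
        intro n hn
        have hnA : n ∈ A := (Finset.mem_filter.mp (Finset.mem_filter.mp hn).1).1
        have h1 : 1 ≤ n / d := by
          by_contra h0
          have : n / d = 0 := Nat.lt_one_iff.mp (not_le.mp h0)
          exact (Finset.mem_filter.mp hn).2 (by rw [this]; simp)
        calc Λ (n / d) ≤ Real.log ((n / d : ℕ) : ℝ) := ArithmeticFunction.vonMangoldt_le_log
          _ ≤ Real.log X := Real.log_le_log (by exact_mod_cast h1)
              (by exact_mod_cast (Nat.div_le_self n d).trans (hmemA n hnA).2.1)
      by_cases hzK : z ≤ K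
      · -- the pair sieve with forms `(k, dk + h)`, `w₁ = w₂ = z`
        have hdet : PairLinearSieve.det 1 0 d h = h := by
          simp [PairLinearSieve.det]
        have hS := HS K 1 0 d h le_rfl (by omega) (by rw [hdet]; exact hh0) z z hz hzK hz hzK
        rw [hdet, Nat.totient_one, Nat.cast_one, div_one, mul_one] at hS
        have hinj : (#B' : ℝ) ≤ #{k ∈ Icc 1 K | (∀ p ∈ ((1 : ℕ) * k + 0).primeFactors, z ≤ (p : ℝ)) ∧
            (∀ p ∈ (d * k + h).primeFactors, z ≤ (p : ℝ) ∨ p ∣ d * h)} := by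
          refine Nat.cast_le.mpr (Finset.card_le_card_of_injOn (fun n => n / d) ?_ ?_)
          · intro n hn
            have hn' := Finset.mem_filter.mp (Finset.mem_coe.mp hn)
            have hnB := Finset.mem_filter.mp hn'.1
            have hnA := hnB.1
            obtain ⟨c, hc⟩ := hnB.2
            have hn0 : n ≠ 0 := by have := (hmemA n hnA).1; omega
            have hc0 : c ≠ 0 := by rintro rfl; simp at hc; exact hn0 hc
            have hnd : n / d = c := by rw [hc, Nat.mul_div_cancel_left _ (Nat.pos_of_ne_zero hd0)]
            rw [Finset.mem_coe, Finset.mem_filter, Finset.mem_Icc]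
            dsimp only
            rw [hnd]
            refine ⟨⟨Nat.one_le_iff_ne_zero.mpr hc0, ?_⟩, ?_, ?_⟩
            · rw [hK, Nat.le_div_iff_mul_le (Nat.pos_of_ne_zero hd0), mul_comm, ← hc]
              exact (hmemA n hnA).2.1
            · intro p hp
              rw [one_mul, add_zero] at hp
              refine (hmemA n hnA).2.2.1 p ?_
              rw [Nat.mem_primeFactors] at hp ⊢
              exact ⟨hp.1, hp.2.1.trans ⟨d, by rw [hc, mul_comm]⟩, hn0⟩
            · intro p hp
              rw [← hc] at hp
              exact Or.inl ((hmemA n hnA).2.2.2 p hp).1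
          · intro n₁ hn₁ n₂ hn₂ heq
            have h1 := (Finset.mem_filter.mp (Finset.mem_filter.mp (Finset.mem_coe.mp hn₁)).1).2
            have h2 := (Finset.mem_filter.mp (Finset.mem_filter.mp (Finset.mem_coe.mp hn₂)).1).2
            dsimp only at heq
            have := congrArg (· * d) heq
            simp only [Nat.div_mul_cancel h1, Nat.div_mul_cancel h2] at this
            exact this
        calc ∑ n ∈ B', Λ (n / d) ≤ ∑ n ∈ B', Real.log X := Finset.sum_le_sum hΛle
          _ = #B' * Real.log X := by rw [Finset.sum_const, nsmul_eq_mul]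
          _ ≤ (C * (((d * h : ℕ) : ℝ) / Nat.totient (d * h)) * (K : ℝ) / (Real.log z * Real.log z)) *
              Real.log X := mul_le_mul_of_nonneg_right (hinj.trans hS) hlogX.le
          _ = Real.log X * (C * (((d * h : ℕ) : ℝ) / Nat.totient (d * h)) * (K : ℝ) / Real.log z ^ 2) := by
              ring
      · -- `K < z`: no prime power `k = n/d ≥ z` fits, the sum is empty
        have hB'0 : B' = ∅ := by
          rw [hB', Finset.filter_eq_empty_iff]
          intro n hn hΛ
          have hnB := Finset.mem_filter.mp hn
          have hnA := hnB.1
          obtain ⟨c, hc⟩ := hnB.2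
          have hn0 : n ≠ 0 := by have := (hmemA n hnA).1; omega
          have hnd : n / d = c := by rw [hc, Nat.mul_div_cancel_left _ (Nat.pos_of_ne_zero hd0)]
          rw [hnd] at hΛ
          rw [ArithmeticFunction.vonMangoldt_ne_zero_iff] at hΛ
          -- `c` is a prime power `p^a` with `p ≥ z`, so `c ≥ z > K ≥ c`: contradiction
          have hcK : c ≤ K := by
            rw [hK, Nat.le_div_iff_mul_le (Nat.pos_of_ne_zero hd0), mul_comm, ← hc]
            exact (hmemA n hnA).2.1
          have hp := hΛ.minFac_pow_factorization_eq
          have hc1 : c ≠ 1 := hΛ.ne_one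
          have hpmem : c.minFac ∈ n.primeFactors :=
            Nat.mem_primeFactors.mpr ⟨Nat.minFac_prime hc1, (Nat.minFac_dvd c).trans ⟨d, by rw [hc, mul_comm]⟩, hn0⟩
          have hzp : z ≤ (c.minFac : ℝ) := (hmemA n hnA).2.2.1 _ hpmem
          have hc0 : c ≠ 0 := hΛ.ne_zero
          have hpc : (c.minFac : ℝ) ≤ c := by exact_mod_cast Nat.minFac_le (Nat.pos_of_ne_zero hc0)
          have : (c : ℝ) ≤ K := by exact_mod_cast hcK
          linarith
        rw [hB'0, Finset.sum_empty]
        positivity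
    · -- `d ∉ D`: `d` is not a `z`-rough number `≥ z`, no admissible multiple
      rw [if_neg hdD]
      have hB0 : ∑ n ∈ A.filter (fun n => d ∣ n), Λ (n / d) = 0 := by
        refine Finset.sum_eq_zero fun n hn => ?_
        exfalso
        have hnB := Finset.mem_filter.mp hn
        have hnA := hnB.1
        have hn0 : n ≠ 0 := by have := (hmemA n hnA).1; omega
        apply hdD
        rw [hD, Finset.mem_filter, Finset.mem_Icc]
        have hrough : ∀ p ∈ d.primeFactors, z ≤ (p : ℝ) := fun p hp =>
          (hmemA n hnA).2.2.1 p (Nat.mem_primeFactors.mpr ⟨Nat.prime_of_mem_primeFactors hp,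
            (Nat.dvd_of_mem_primeFactors hp).trans hnB.2, hn0⟩)
        refine ⟨⟨Nat.ceil_le.mpr ?_, hd.2⟩, hrough⟩
        exact le_of_dvd_of_rough hn0 (hmemA n hnA).2.2.1 hnB.2 (by omega)
      rw [hB0, mul_zero]
  -- Step 3: sum over `d`
  have hstep3 : ∑ d ∈ Icc 2 X, ∑ n ∈ A.filter (fun n => d ∣ n), oneConvChi χ d * Λ (n / d) ≤
      ∑ d ∈ Icc 2 X, (if d ∈ D then oneConvChi χ d * (Real.log X * (C * (((d * h : ℕ) : ℝ) /
        Nat.totient (d * h)) * ((X / d : ℕ) : ℝ) / Real.log z ^ 2)) else 0) :=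
    Finset.sum_le_sum hinner
  refine hstep3.trans ?_
  rw [← Finset.sum_filter, Finset.mul_sum]
  have h2z : 2 ≤ ⌈z⌉₊ := by
    have := Nat.le_ceil z
    exact_mod_cast hz.trans this
  have hDsub : (Icc 2 X).filter (fun d => d ∈ D) = D := by
    ext d
    rw [Finset.mem_filter, Finset.mem_Icc, hD, Finset.mem_filter, Finset.mem_Icc]
    constructor
    · rintro ⟨-, h2⟩; exact h2
    · rintro ⟨⟨h1, h2⟩, h3⟩
      exact ⟨⟨h2z.trans h1, h2⟩, ⟨h1, h2⟩, h3⟩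
  rw [hDsub]
  refine Finset.sum_le_sum fun d hd => ?_
  have hdmem := hd
  rw [hD, Finset.mem_filter, Finset.mem_Icc] at hdmem
  have hd2 : 2 ≤ d := h2z.trans hdmem.1.1
  have hd0 : d ≠ 0 := by omega
  have hdR : (0 : ℝ) < d := by exact_mod_cast (show 0 < d by omega)
  have hlam0 : 0 ≤ oneConvChi χ d := oneConvChi_nonneg χ hχ d
  have hφ := mul_div_totient_le hd0 hh0
  rw [← hw] at hφ
  have hKd : ((X / d : ℕ) : ℝ) ≤ (X : ℝ) / d := Nat.cast_div_le
  have hdφ0 : 0 ≤ (d : ℝ) / Nat.totient d := by positivity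
  have hdh0 : 0 ≤ ((d * h : ℕ) : ℝ) / Nat.totient (d * h) := by positivity
  have hin : C * (((d * h : ℕ) : ℝ) / Nat.totient (d * h)) * ((X / d : ℕ) : ℝ) / Real.log z ^ 2 ≤
      C * ((d : ℝ) / Nat.totient d * w) * ((X : ℝ) / d) / Real.log z ^ 2 := by
    refine div_le_div_of_nonneg_right ?_ (sq_nonneg _)
    exact mul_le_mul (mul_le_mul_of_nonneg_left hφ hC.le) hKd (Nat.cast_nonneg _) (by positivity)
  calc oneConvChi χ d * (Real.log X * (C * (((d * h : ℕ) : ℝ) / Nat.totient (d * h)) *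
        ((X / d : ℕ) : ℝ) / Real.log z ^ 2))
      ≤ oneConvChi χ d * (Real.log X * (C * ((d : ℝ) / Nat.totient d * w) * ((X : ℝ) / d) /
          Real.log z ^ 2)) :=
        mul_le_mul_of_nonneg_left (mul_le_mul_of_nonneg_left hin hlogX.le) hlam0
    _ = C * w * X * (Real.log X / Real.log z ^ 2) * (oneConvChi χ d * ((d : ℝ) / Nat.totient d) / d) := by
        field_simp

end Literature.Barriers.Parity.MatomakiMerikoski
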